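import Summits.MatrixMultiplication.MatrixMultiplication.Theorems.LevelGradedCohnUmansLevelOneGL2DesignsHermitianLift
import Summits.MatrixMultiplication.MatrixMultiplication.Theorems.LevelGradedCohnUmansLevelOneGL2DesignsGaussLift
import Summits.MatrixMultiplication.MatrixMultiplication.Theorems.LevelGradedCohnUmansLevelOneGL2DesignsStubTangencySetsHermitianReduction

/-!
# The Gaussian door of the lifted unital: norm-difference-free sets of exponent `γ` give strong
representative systems of exponent `1 + γ/2` at every prime `p ≡ 1 (mod 4)` — stub `stub_tangencySets`
(crux `LevelOneGL2Designs`, stmt-MatrixMultiplication-14080), wall-breaker axis 10/12 "Hermitian unital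
constructions", generation 1 (seat 3), cycle 2, part 9

The σ-Hermitian lift of seat 7-3 (`HermitianLift.tangencySet_of_hermitianLift_graph`) run over the
Gaussian integers `ℤ[i] = ℤ√(-1)` with `σ` = conjugation and `g : ℤ[i] → ZMod p` the reduction at a
square root `s` of `-1` (`p ≡ 1 (mod 4)`): points `(x, x·x̄ + u)`, `x` in the box `[0,B)²`,
`u = c + t·i` with `t ∈ [0,L)` free and the real parts `c` taken from a set `U ⊆ [0,L)` NO TWO OF WHOSE
ELEMENTS DIFFER BY A SUM OF TWO SQUARES.  The heights are `u + ū = 2c`, the norms `2(x−x')·σ(x−x')`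
are `2(a² + b²)`, so condition (ii) of the lift is exactly the property of `U`; condition (i) (no
wrap-around) holds in the window `B² ≤ L`, `100·L² ≤ p` by `ParabolaLift.gauss_noWrap` (axis k2).

* `gaussianUnital_door` — the tangency set: `B²·L·|U|` points of `AG(2,p)`, each with a private line;
* `srs_of_normFree_exponent` — THE DOOR AS AN IMPLICATION (seat 7-3's residual R8′, kernel-checked): if
  `[0,L)` carries such sets of size `≥ c·L^γ` for every `L` (`0 ≤ γ ≤ 1`), then every prime
  `p ≡ 1 (mod 4)` has a strong representative system in the format of `stub_tangencySets` with at least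
  `(c/64000)·p^{1+γ/2}` flags;
* (part 10, `…GaussianUnitalFiveFourths`) feeds the door with the base-`9` digit sets of part 8
  (`γ = 1/2`): `≥ p^{5/4}/192000` flags for every `p ≡ 1 (mod 4)` — the unital's own route to `5/4`.

With parts 6–8 (`…GaussianUnitalResidue{Cap,Rule,Digits}`: every residue rule has `|D|² ≤ m`, so local
inputs have `γ ≤ 1/2`) this closes the record of R8′: door `γ ↦ 1 + γ/2`, local input `= 1/2` exactly,
output `5/4`; beyond needs a non-local `U` (`γ₂ ∈ [1/2,1]` open; Rice 2019: `|U| ≤ L·e^{−c√log L}`, so the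
door never yields the stub's constant).  Elementary given the imported files; no definitions.
-/

-- `Summit.MatrixMultiplication.MatrixMultiplication.…` is the tree's mandated summit/problem namespace (D-0017).
set_option linter.dupNamespace false

namespace Summit.MatrixMultiplication.MatrixMultiplication.Theorems.LevelOneGL2Designs.GaussianUnital

open Finset Matrix
open Summit.MatrixMultiplication.MatrixMultiplication.Theorems.LevelOneGL2Designs.HermitianLift
  (tangencySet_of_hermitianLift_graph)
open Summit.MatrixMultiplication.MatrixMultiplication.Theorems.LevelOneGL2Designs.ParabolaLift
  (gauss_noWrap)
open Summit.MatrixMultiplication.MatrixMultiplication.Theorems.LevelOneGL2Designs.FlagLine.TangencyHermitian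
  (srs_of_tangencySet)

/-- **The Gaussian door of the lifted unital (tangency-set form).**  Let `s² = -1` in `ZMod p`, let
`B² ≤ L` and `100·L² ≤ p`, and let `U ⊆ [0,L)` be a finite set of integers no two of which differ by a
sum of two squares.  Then the reductions of the points `(x, x·x̄ + u)` of `ℤ[i]²` — `x = a + bi` with
`a, b ∈ [0,B)`, `u = c + ti` with `c ∈ U`, `t ∈ [0,L)` — under `a + bi ↦ a + b·s` are `B²·(|U|·L)`
distinct points of `AG(2,p)`, and the reduced Hermitian tangent at each of them (normal
`(2·g(x̄'), −1)`) contains no other: an affine tangency set.  [`HermitianLift.tangencySet_of_hermitianLift_graph`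
with `O = ℤ√(-1)`, `σ = star`, `g = Zsqrtd.lift s`; no wrap-around by `ParabolaLift.gauss_noWrap`] -/
theorem gaussianUnital_door {p : ℕ} [Fact p.Prime] (s : ZMod p) (hs : s ^ 2 = -1)
    (B L : ℕ) (hB : B ^ 2 ≤ L) (hL : 100 * L ^ 2 ≤ p)
    (U : Finset ℤ) (hU : ∀ c ∈ U, 0 ≤ c ∧ c < L)
    (hfree : ∀ c ∈ U, ∀ c' ∈ U, c ≠ c' → ¬ ∃ x y : ℕ, (c - c').natAbs = x ^ 2 + y ^ 2) :
    ∃ W : Finset (Fin 2 → ZMod p), W.card = B ^ 2 * (U.card * L) ∧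
      ∀ v ∈ W, ∃ u : Fin 2 → ZMod p, u ≠ 0 ∧ ∀ w ∈ W, u ⬝ᵥ w = u ⬝ᵥ v → w = v := by
  classical
  -- the ring data: `O = ℤ√(-1)`, `σ = star`, `g = lift s`
  have hs' : s * s = ((-1 : ℤ) : ZMod p) := by rw [← sq, hs]; push_cast; ring
  set g : ℤ√(-1) →+* ZMod p := Zsqrtd.lift ⟨s, hs'⟩ with hgdef
  set σ : ℤ√(-1) →+* ℤ√(-1) := starRingEnd (ℤ√(-1)) with hσdef
  have hσ : ∀ z, σ (σ z) = z := fun z => starRingEnd_self_apply z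
  -- the box `X = [0,B)²` and the height data `Uz = U × [0,L)`
  set X : Finset (ℤ√(-1)) := (range B ×ˢ range B).image fun ab => ⟨(ab.1 : ℤ), (ab.2 : ℤ)⟩ with hXdef
  set Uz : Finset (ℤ√(-1)) := (U ×ˢ range L).image fun ct => ⟨ct.1, (ct.2 : ℤ)⟩ with hUzdef
  have hXcard : X.card = B ^ 2 := by
    rw [hXdef, card_image_of_injective, card_product, card_range, sq]
    rintro ⟨a, b⟩ ⟨a', b'⟩ h
    simp only [Zsqrtd.mk.injEq, Nat.cast_inj] at h
    rw [h.1, h.2]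
  have hUzcard : Uz.card = U.card * L := by
    rw [hUzdef, card_image_of_injective, card_product, card_range]
    rintro ⟨c, t⟩ ⟨c', t'⟩ h
    simp only [Zsqrtd.mk.injEq, Nat.cast_inj] at h
    rw [h.1, h.2]
  -- membership unpacking
  have hXmem : ∀ x ∈ X, ∃ a b : ℕ, a < B ∧ b < B ∧ x = ⟨(a : ℤ), (b : ℤ)⟩ := by
    intro x hx
    rw [hXdef, mem_image] at hx
    obtain ⟨⟨a, b⟩, hab, rfl⟩ := hx
    rw [mem_product, mem_range, mem_range] at hab
    exact ⟨a, b, hab.1, hab.2, rfl⟩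
  have hUzmem : ∀ u ∈ Uz, ∃ c : ℤ, ∃ t : ℕ, c ∈ U ∧ t < L ∧ u = ⟨c, (t : ℤ)⟩ := by
    intro u hu
    rw [hUzdef, mem_image] at hu
    obtain ⟨⟨c, t⟩, hct, rfl⟩ := hu
    rw [mem_product, mem_range] at hct
    exact ⟨c, t, hct.1, hct.2, rfl⟩
  -- integer window facts
  have hLZ : (100 : ℤ) * (L : ℤ) ^ 2 ≤ p := by exact_mod_cast hL
  have hBL : ((B : ℤ)) ^ 2 ≤ L := by exact_mod_cast hB
  have prod_le : ∀ m n : ℕ, m < B → n < B → (0 : ℤ) ≤ (m : ℤ) * n ∧ (m : ℤ) * n ≤ L := by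
    intro m n hm hn
    refine ⟨by positivity, ?_⟩
    have h1 : (m : ℤ) * n ≤ (B : ℤ) * B :=
      mul_le_mul (by exact_mod_cast hm.le) (by exact_mod_cast hn.le) (by positivity) (by positivity)
    nlinarith
  rw [← hXcard, ← hUzcard]
  refine tangencySet_of_hermitianLift_graph σ hσ g X Uz ?_ ?_
  · -- (i) no wrap-around: the collision element has norm `< p`
    intro x hx x' hx' u hu u' hu' hgF
    obtain ⟨a, b, ha, hb, rfl⟩ := hXmem x hx
    obtain ⟨a', b', ha', hb', rfl⟩ := hXmem x' hx'
    obtain ⟨c, t, hc, ht, rfl⟩ := hUzmem u hu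
    obtain ⟨c', t', hc', ht', rfl⟩ := hUzmem u' hu'
    set F : ℤ√(-1) := 2 * ((⟨(a : ℤ), (b : ℤ)⟩ : ℤ√(-1)) - ⟨(a' : ℤ), (b' : ℤ)⟩) * σ ⟨(a' : ℤ), (b' : ℤ)⟩ -
      (((⟨(a : ℤ), (b : ℤ)⟩ : ℤ√(-1)) * σ ⟨(a : ℤ), (b : ℤ)⟩ + ⟨c, (t : ℤ)⟩) -
        ((⟨(a' : ℤ), (b' : ℤ)⟩ : ℤ√(-1)) * σ ⟨(a' : ℤ), (b' : ℤ)⟩ + ⟨c', (t' : ℤ)⟩)) with hFdef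
    have hre : F.re = 2 * ((a : ℤ) * a' + (b : ℤ) * b') - 2 * ((a' : ℤ) * a' + (b' : ℤ) * b')
        - ((a : ℤ) * a + (b : ℤ) * b + c) + ((a' : ℤ) * a' + (b' : ℤ) * b' + c') := by
      simp only [hFdef, hσdef, starRingEnd_apply, Zsqrtd.re_sub, Zsqrtd.re_add, Zsqrtd.re_mul,
        Zsqrtd.im_mul, Zsqrtd.re_star, Zsqrtd.im_star, Zsqrtd.re_ofNat, Zsqrtd.im_ofNat,
        Zsqrtd.im_sub]
      ring
    have him : F.im = 2 * ((b : ℤ) * a' - (a : ℤ) * b') - (t : ℤ) + t' := by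
      simp only [hFdef, hσdef, starRingEnd_apply, Zsqrtd.im_sub, Zsqrtd.im_add, Zsqrtd.re_mul,
        Zsqrtd.im_mul, Zsqrtd.re_star, Zsqrtd.im_star, Zsqrtd.re_ofNat, Zsqrtd.im_ofNat,
        Zsqrtd.re_sub]
      ring
    -- sizes
    obtain ⟨hc0, hcL⟩ := hU c hc
    obtain ⟨hc0', hcL'⟩ := hU c' hc'
    have htZ : (t : ℤ) < L := by exact_mod_cast ht
    have htZ' : (t' : ℤ) < L := by exact_mod_cast ht'
    obtain ⟨p1, q1⟩ := prod_le a a' ha ha'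
    obtain ⟨p2, q2⟩ := prod_le b b' hb hb'
    obtain ⟨p3, q3⟩ := prod_le a' a' ha' ha'
    obtain ⟨p4, q4⟩ := prod_le b' b' hb' hb'
    obtain ⟨p5, q5⟩ := prod_le a a ha ha
    obtain ⟨p6, q6⟩ := prod_le b b hb hb
    obtain ⟨p7, q7⟩ := prod_le b a' hb ha'
    obtain ⟨p8, q8⟩ := prod_le a b' ha hb'
    have hre_bd : -(7 * (L : ℤ)) ≤ F.re ∧ F.re ≤ 7 * L := by
      rw [hre]; constructor <;> linarith
    have him_bd : -(3 * (L : ℤ)) ≤ F.im ∧ F.im ≤ 3 * L := by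
      rw [him]; constructor <;> linarith
    have hnorm : F.re ^ 2 + F.im ^ 2 < p := by
      have h1 : F.re ^ 2 ≤ (7 * (L : ℤ)) ^ 2 := sq_le_sq' hre_bd.1 hre_bd.2
      have h2 : F.im ^ 2 ≤ (3 * (L : ℤ)) ^ 2 := sq_le_sq' him_bd.1 him_bd.2
      rcases Nat.eq_zero_or_pos L with hL0 | hLpos
      · -- degenerate window: everything is `0`
        subst hL0
        have h3 : F.re = 0 := by push_cast at hre_bd; linarith [hre_bd.1, hre_bd.2]
        have h4 : F.im = 0 := by push_cast at him_bd; linarith [him_bd.1, him_bd.2]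
        rw [h3, h4]
        exact_mod_cast (Fact.out : p.Prime).pos
      · have hL2 : (0 : ℤ) < (L : ℤ) ^ 2 := by positivity
        calc F.re ^ 2 + F.im ^ 2 ≤ (7 * (L : ℤ)) ^ 2 + (3 * (L : ℤ)) ^ 2 := add_le_add h1 h2
          _ = 58 * (L : ℤ) ^ 2 := by ring
          _ < p := by linarith
    have hgF' : (F.re : ZMod p) + F.im * s = 0 := by
      have := hgF
      rw [hgdef, Zsqrtd.lift_apply_apply] at this
      exact this
    obtain ⟨h0re, h0im⟩ := gauss_noWrap s hs F.re F.im hnorm hgF'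
    exact Zsqrtd.ext (by rw [h0re]; rfl) (by rw [h0im]; rfl)
  · -- (ii) heights: `2(c' - c) = 2((a-a')² + (b-b')²)` forces `c = c'` (the property of `U`), then `x = x'`
    intro x hx x' hx' u hu u' hu' heq
    obtain ⟨a, b, ha, hb, rfl⟩ := hXmem x hx
    obtain ⟨a', b', ha', hb', rfl⟩ := hXmem x' hx'
    obtain ⟨c, t, hc, ht, rfl⟩ := hUzmem u hu
    obtain ⟨c', t', hc', ht', rfl⟩ := hUzmem u' hu'
    have hre := congrArg Zsqrtd.re heq
    simp only [hσdef, starRingEnd_apply, Zsqrtd.re_sub, Zsqrtd.re_add, Zsqrtd.re_mul,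
      Zsqrtd.im_mul, Zsqrtd.re_star, Zsqrtd.im_star, Zsqrtd.re_ofNat, Zsqrtd.im_ofNat,
      Zsqrtd.im_sub] at hre
    -- `hre : c' + c' - (c + c) = 2 * ((a-a')(a-a') - (-1)(b-b')(-(b-b')))`-ish; normalise
    have hcc : c' - c = ((a : ℤ) - a') ^ 2 + ((b : ℤ) - b') ^ 2 := by
      have h2 : (2 : ℤ) * (c' - c) = 2 * (((a : ℤ) - a') ^ 2 + ((b : ℤ) - b') ^ 2) := by
        linear_combination hre
      exact mul_left_cancel₀ two_ne_zero h2
    by_cases hceq : c = c'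
    · subst hceq
      rw [sub_self] at hcc
      obtain ⟨ha2, hb2⟩ := (add_eq_zero_iff_of_nonneg (sq_nonneg _) (sq_nonneg _)).mp hcc.symm
      have ha0 : (a : ℤ) - a' = 0 := pow_eq_zero_iff (two_ne_zero) |>.mp ha2
      have hb0 : (b : ℤ) - b' = 0 := pow_eq_zero_iff (two_ne_zero) |>.mp hb2
      exact Zsqrtd.ext (by simp only; linarith) (by simp only; linarith)
    · exfalso
      refine hfree c' hc' c hc (Ne.symm hceq) ⟨((a : ℤ) - a').natAbs, ((b : ℤ) - b').natAbs, ?_⟩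
      have h0 : (0 : ℤ) ≤ c' - c := by rw [hcc]; positivity
      zify
      rw [abs_of_nonneg h0, hcc, sq_abs, sq_abs]

/-- **The door as an implication (R8′ of the axis, kernel-checked).**  Suppose that for every `L` the
interval `[0,L)` contains a set of at least `c·L^γ` integers no two of which differ by a sum of two
squares (`0 ≤ γ ≤ 1`, `c > 0`).  Then EVERY prime `p ≡ 1 (mod 4)` carries a strong representative
system of `AG(2,p)` in the format of `stub_tangencySets` with at least `(c/64000)·p^{1+γ/2}` flags: run
`gaussianUnital_door` at the scale `L = ⌊√p⌋/10`, `B = ⌊√L⌋` (so `B²·L·|U| ≥ (c/4)·L^{2+γ}` and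
`L ≥ √p/20` for `p ≥ 400`) and halve once for the stub's normalisation (`srs_of_tangencySet`); primes
`p < 400` are served by a single flag.  With `γ = 1/2` (base `9`, part 8) this is `5/4`; `γ = γ₂ > 1/2`
would need a non-local construction (parts 6–8), and by Rice (2019) `γ = 1` with a constant is
impossible, so the door never reaches `c·p^{3/2}`. [this file] -/
theorem srs_of_normFree_exponent {γ c : ℝ} (hγ0 : 0 ≤ γ) (hγ1 : γ ≤ 1) (hc : 0 < c)
    (h : ∀ L : ℕ, ∃ U : Finset ℤ, c * (L : ℝ) ^ γ ≤ U.card ∧ (∀ a ∈ U, 0 ≤ a ∧ a < L) ∧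
      ∀ a ∈ U, ∀ a' ∈ U, a ≠ a' → ¬ ∃ x y : ℕ, (a - a').natAbs = x ^ 2 + y ^ 2)
    {p : ℕ} [Fact p.Prime] (hp : p % 4 = 1) :
    ∃ S : Finset ((Fin 2 → ZMod p) × (Fin 2 → ZMod p)),
      c / 64000 * (p : ℝ) ^ (1 + γ / 2) ≤ S.card ∧
      ∀ f ∈ S, ∀ f' ∈ S, (dotProduct f.1 f'.2 = 1 ↔ f = f') := by
  classical
  have hpr : p.Prime := Fact.out
  -- `c ≤ 1`: the interval `[0,1)` holds at most one integer
  have hc1 : c ≤ 1 := by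
    obtain ⟨U, hUc, hUbox, -⟩ := h 1
    have hU1 : U.card ≤ 1 := by
      rw [card_le_one]
      intro a ha b hb
      obtain ⟨h1, h2⟩ := hUbox a ha
      obtain ⟨h3, h4⟩ := hUbox b hb
      push_cast at h2 h4
      omega
    have e1 : c * ((1 : ℕ) : ℝ) ^ γ = c := by simp
    rw [e1] at hUc
    have : (U.card : ℝ) ≤ 1 := by exact_mod_cast hU1
    linarith
  -- a square root of `-1`
  obtain ⟨s, hs⟩ : IsSquare (-1 : ZMod p) := ZMod.exists_sq_eq_neg_one_iff.mpr (by omega)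
  have hs2 : s ^ 2 = -1 := by rw [sq]; exact hs.symm
  -- scales: `r = ⌊√p⌋`, `L = ⌊r/10⌋`, `B = ⌊√L⌋`
  set r : ℕ := Nat.sqrt p with hr
  set L : ℕ := r / 10 with hLdef
  set B : ℕ := Nat.sqrt L with hBdef
  have hr1 : r * r ≤ p := Nat.sqrt_le p
  have hr2 : p < (r + 1) * (r + 1) := Nat.lt_succ_sqrt p
  have hB1 : B * B ≤ L := Nat.sqrt_le L
  have hB2 : L < (B + 1) * (B + 1) := Nat.lt_succ_sqrt L
  have h10 : 10 * L ≤ r := Nat.mul_div_le r 10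
  have hwin : 100 * L ^ 2 ≤ p := by nlinarith
  rcases lt_or_ge p 400 with hsmall | hlarge
  · -- small primes: one flag
    refine ⟨{(![1, 0], ![1, 0])}, ?_, ?_⟩
    · simp only [card_singleton, Nat.cast_one]
      have hp400 : (p : ℝ) ≤ 400 := by exact_mod_cast hsmall.le
      have hpow : (p : ℝ) ^ (1 + γ / 2) ≤ (400 : ℝ) ^ ((3 : ℝ) / 2) :=
        calc (p : ℝ) ^ (1 + γ / 2) ≤ (400 : ℝ) ^ (1 + γ / 2) :=
              Real.rpow_le_rpow (by positivity) hp400 (by linarith)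
          _ ≤ (400 : ℝ) ^ ((3 : ℝ) / 2) :=
              Real.rpow_le_rpow_of_exponent_le (by norm_num) (by linarith)
      have h400 : (400 : ℝ) ^ ((3 : ℝ) / 2) = 8000 := by
        rw [show (400 : ℝ) = 20 ^ (2 : ℝ) by norm_num, ← Real.rpow_mul (by norm_num)]
        norm_num
      rw [h400] at hpow
      calc c / 64000 * (p : ℝ) ^ (1 + γ / 2) ≤ 1 / 64000 * 8000 := by gcongr
        _ ≤ 1 := by norm_num
    · intro f hf f' hf'
      rw [mem_singleton] at hf hf'
      subst hf hf'
      simp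
  · -- `p ≥ 400`: the door at scale `L`
    obtain ⟨U, hUc, hUbox, hUfree⟩ := h L
    obtain ⟨W, hWcard, hW⟩ :=
      gaussianUnital_door s hs2 B L (by rw [sq]; exact hB1) hwin U hUbox hUfree
    choose! u hu using hW
    obtain ⟨S, hS, hsrs⟩ :=
      srs_of_tangencySet W u (fun v hv => (hu v hv).1) (fun v hv => (hu v hv).2)
    refine ⟨S, ?_, hsrs⟩
    have hp2 : (2 : ℝ) ≤ p := by exact_mod_cast hpr.two_le
    have hS' : (W.card : ℝ) * p ≤ S.card * p + W.card := by
      have := hS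
      rw [ZMod.card] at this
      exact_mod_cast this
    have hSW : (W.card : ℝ) ≤ 2 * S.card := by nlinarith
    -- `r ≥ 20`, `L ≥ 2`, `B ≥ 1`, `L ≤ 4B²`
    have hr20 : 20 ≤ r := by nlinarith
    have hL1 : 1 ≤ L := by omega
    have hB0 : B ≠ 0 := fun h0 => by rw [h0] at hB2; omega
    have h4B : L ≤ 4 * (B * B) := by
      have : 1 ≤ B := Nat.pos_of_ne_zero hB0
      nlinarith
    -- `√p ≤ 20 L`
    have hsqrt : Real.sqrt p ≤ 20 * L := by
      have h1 : Real.sqrt p < r + 1 := by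
        have := Real.real_sqrt_lt_nat_sqrt_succ (a := p)
        simpa [hr] using this
      have h2 : (r : ℝ) + 1 ≤ 10 * L + 10 := by
        exact_mod_cast (by omega : r + 1 ≤ 10 * L + 10)
      have h3 : (10 : ℝ) ≤ 10 * L := by exact_mod_cast (by omega : 10 ≤ 10 * L)
      linarith
    have hL0 : (0 : ℝ) < L := by exact_mod_cast hL1
    -- `p^{1+γ/2} = (√p)^{2+γ} ≤ (20L)^{2+γ} ≤ 8000 · L² · L^γ`
    have hkey : (p : ℝ) ^ (1 + γ / 2) ≤ 8000 * ((L : ℝ) ^ 2 * (L : ℝ) ^ γ) := by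
      have e1 : (p : ℝ) ^ (1 + γ / 2) = (Real.sqrt p) ^ (2 + γ) := by
        rw [Real.sqrt_eq_rpow, ← Real.rpow_mul (by positivity)]
        congr 1
        ring
      rw [e1]
      calc (Real.sqrt p) ^ (2 + γ) ≤ (20 * (L : ℝ)) ^ (2 + γ) :=
            Real.rpow_le_rpow (Real.sqrt_nonneg _) hsqrt (by linarith)
        _ = (20 : ℝ) ^ (2 + γ) * (L : ℝ) ^ (2 + γ) := Real.mul_rpow (by norm_num) hL0.le
        _ ≤ 8000 * ((L : ℝ) ^ 2 * (L : ℝ) ^ γ) := by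
            have h20 : (20 : ℝ) ^ (2 + γ) ≤ (20 : ℝ) ^ (3 : ℝ) :=
              Real.rpow_le_rpow_of_exponent_le (by norm_num) (by linarith)
            have h20' : (20 : ℝ) ^ (3 : ℝ) = 8000 := by norm_num
            have hL' : (L : ℝ) ^ (2 + γ) = (L : ℝ) ^ 2 * (L : ℝ) ^ γ := by
              rw [Real.rpow_add hL0, Real.rpow_two]
            rw [hL']
            have h0 : (0 : ℝ) ≤ (L : ℝ) ^ 2 * (L : ℝ) ^ γ := by positivity
            exact mul_le_mul_of_nonneg_right (h20.trans_eq h20') h0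
    -- `|W| = B² · |U| · L ≥ (L/4) · (c L^γ) · L`
    have hWR : (W.card : ℝ) = (B : ℝ) ^ 2 * U.card * L := by rw [hWcard]; push_cast; ring
    have hLB : (L : ℝ) / 4 ≤ (B : ℝ) ^ 2 := by
      have : (L : ℝ) ≤ 4 * ((B : ℝ) * B) := by exact_mod_cast h4B
      nlinarith
    have hU0 : (0 : ℝ) ≤ U.card := by positivity
    have step : (L : ℝ) / 4 * (c * (L : ℝ) ^ γ) ≤ (B : ℝ) ^ 2 * U.card :=
      mul_le_mul hLB hUc (by positivity) (by positivity)
    calc c / 64000 * (p : ℝ) ^ (1 + γ / 2)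
        ≤ c / 64000 * (8000 * ((L : ℝ) ^ 2 * (L : ℝ) ^ γ)) := by gcongr
      _ = ((L : ℝ) / 4 * (c * (L : ℝ) ^ γ)) * ((L : ℝ) / 2) := by ring
      _ ≤ ((B : ℝ) ^ 2 * U.card) * ((L : ℝ) / 2) := mul_le_mul_of_nonneg_right step (by positivity)
      _ = W.card / 2 := by rw [hWR]; ring
      _ ≤ S.card := by linarith

end Summit.MatrixMultiplication.MatrixMultiplication.Theorems.LevelOneGL2Designs.GaussianUnital
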